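import Mathlib.Analysis.InnerProductSpace.Basic
import Mathlib.Analysis.SpecialFunctions.Pow.Real
import HarnessLib

/-!
# K1L_D (stmt-AnomalousDissipation-27980), stub `stub_oneLevelL_IW`: DATUM TRIMMING for the window ledger (finding F-lead-5)
# (helper; `--supports … --as helper`; companion of `…LagrangianStepWindowLedger` p644546)

Pure Hilbert-space algebra (lead-k1l-onelevel-p1 g2, 2026-08-28).  A class-`R` datum carries an `H¹` tail above the tracked frequency range which the
homogenised dynamics kills at once and the true dynamics keeps; it is negligible as ENERGY but cannot go through the ledger's dissipation-dominated /
leftover bookkeeping (F-lead-5).  Remedy: split the datum orthogonally `w = w¹ + w²` (`w¹` band-limited, `w²` the small tail), run the ledger on `w¹`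
alone, and control the cross terms by the POLARISATION inequality of a contraction `T`:
`|⟪T x, T y⟫ − ⟪x, y⟫| ≤ √(‖x‖² − ‖T x‖²) · √(‖y‖² − ‖T y‖²)` (`(x, y) ↦ ⟪x,y⟫ − ⟪Tx,Ty⟫` is a positive semidefinite symmetric form).  Consequence
(`trim_compare`): if `‖T₁ w¹‖² ≤ ‖T₀ w¹‖² + ε (‖w¹‖² − ‖T₀ w¹‖²)` (the ledger's output for the trimmed datum, `0 ≤ ε ≤ 1`) then for the full datum
`‖T₁ w‖² ≤ ‖T₀ w‖² + 2ε (‖w‖² − ‖T₀ w‖²) + 6 ‖w²‖ √(‖w‖² − ‖T₀ w‖²) + 15 ‖w²‖²` — every tail term carries `‖w²‖`, to be compared with `ε·drop` by the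
composition (`‖w²‖² ≤ ε²·drop` via the a-priori base drop).  Infrastructure for rung F-D1.A0; NOT a proof of the crux or of anomalous dissipation.
-/

set_option linter.dupNamespace false

namespace Summit.AnomalousDissipation.AnomalousDissipation.Theorems.SolenoidalFractalHomogenisation.LagrangianStep

open scoped InnerProductSpace

noncomputable section

variable {V : Type*} [NormedAddCommGroup V] [InnerProductSpace ℝ V]

/-- **Polarisation inequality of a contraction.**  For a linear contraction `T` of a real inner product space, the defect form
`B(x,y) := ⟪x,y⟫ − ⟪Tx,Ty⟫` is positive semidefinite, hence `|⟪x, y⟫ − ⟪T x, T y⟫| ≤ √(‖x‖² − ‖T x‖²)·√(‖y‖² − ‖T y‖²)`. -/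
theorem abs_inner_sub_inner_apply_le (T : V →L[ℝ] V) (hT : ∀ x, ‖T x‖ ≤ ‖x‖) (x y : V) :
    |⟪x, y⟫_ℝ - ⟪T x, T y⟫_ℝ| ≤ Real.sqrt (‖x‖ ^ 2 - ‖T x‖ ^ 2) * Real.sqrt (‖y‖ ^ 2 - ‖T y‖ ^ 2) := by
  -- the defect form along the pencil `x + s • y`
  set a : ℝ := ‖x‖ ^ 2 - ‖T x‖ ^ 2 with ha_def
  set b : ℝ := ⟪x, y⟫_ℝ - ⟪T x, T y⟫_ℝ with hb_def
  set c : ℝ := ‖y‖ ^ 2 - ‖T y‖ ^ 2 with hc_def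
  have ha : 0 ≤ a := by rw [ha_def]; exact sub_nonneg.2 (pow_le_pow_left₀ (norm_nonneg _) (hT x) 2)
  have hc : 0 ≤ c := by rw [hc_def]; exact sub_nonneg.2 (pow_le_pow_left₀ (norm_nonneg _) (hT y) 2)
  have hpencil : ∀ s : ℝ, 0 ≤ a + 2 * s * b + s ^ 2 * c := by
    intro s
    have h1 : ‖x + s • y‖ ^ 2 = ‖x‖ ^ 2 + 2 * s * ⟪x, y⟫_ℝ + s ^ 2 * ‖y‖ ^ 2 := by
      rw [norm_add_sq_real, real_inner_smul_right, norm_smul, mul_pow, Real.norm_eq_abs, sq_abs]; ring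
    have h2 : ‖T (x + s • y)‖ ^ 2 = ‖T x‖ ^ 2 + 2 * s * ⟪T x, T y⟫_ℝ + s ^ 2 * ‖T y‖ ^ 2 := by
      rw [map_add, map_smul, norm_add_sq_real, real_inner_smul_right, norm_smul, mul_pow, Real.norm_eq_abs, sq_abs]; ring
    have h3 := hT (x + s • y)
    have h4 : ‖T (x + s • y)‖ ^ 2 ≤ ‖x + s • y‖ ^ 2 := pow_le_pow_left₀ (norm_nonneg _) h3 2
    rw [h1, h2] at h4
    rw [ha_def, hb_def, hc_def]; linarith
  -- discriminant: `b² ≤ a c`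
  have hdisc : b ^ 2 ≤ a * c := by
    by_cases hc0 : c = 0
    · -- then `b = 0`
      by_contra hne
      have hb0 : b ≠ 0 := by intro h; apply hne; rw [h, hc0]; simp
      have := hpencil (-(a + 1) / (2 * b))
      rw [hc0, mul_zero, add_zero] at this
      have h5 : 2 * (-(a + 1) / (2 * b)) * b = -(a + 1) := by field_simp
      linarith
    · have hcpos : 0 < c := lt_of_le_of_ne hc (Ne.symm hc0)
      have := hpencil (-b / c)
      have h5 : a + 2 * (-b / c) * b + (-b / c) ^ 2 * c = a - b ^ 2 / c := by field_simp; ring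
      rw [h5] at this
      have h6 : b ^ 2 / c ≤ a := by linarith
      rwa [div_le_iff₀ hcpos] at h6
  -- conclude
  rw [← Real.sqrt_mul ha, ← Real.sqrt_sq (abs_nonneg b)]
  exact Real.sqrt_le_sqrt (by rw [sq_abs]; exact hdisc)

/-- Cross term of an orthogonal split under a contraction: `⟪w¹, w²⟫ = 0 ⇒ |⟪T w¹, T w²⟫| ≤ √(‖w¹‖² − ‖T w¹‖²)·‖w²‖`. -/
theorem abs_inner_apply_le_of_orthogonal (T : V →L[ℝ] V) (hT : ∀ x, ‖T x‖ ≤ ‖x‖) {w₁ w₂ : V} (h : ⟪w₁, w₂⟫_ℝ = 0) :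
    |⟪T w₁, T w₂⟫_ℝ| ≤ Real.sqrt (‖w₁‖ ^ 2 - ‖T w₁‖ ^ 2) * ‖w₂‖ := by
  have h1 := abs_inner_sub_inner_apply_le T hT w₁ w₂
  rw [h, zero_sub, abs_neg] at h1
  have h2 : Real.sqrt (‖w₂‖ ^ 2 - ‖T w₂‖ ^ 2) ≤ ‖w₂‖ := by
    calc Real.sqrt (‖w₂‖ ^ 2 - ‖T w₂‖ ^ 2) ≤ Real.sqrt (‖w₂‖ ^ 2) := Real.sqrt_le_sqrt (by nlinarith [norm_nonneg (T w₂)])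
      _ = ‖w₂‖ := Real.sqrt_sq (norm_nonneg _)
  exact h1.trans (mul_le_mul_of_nonneg_left h2 (Real.sqrt_nonneg _))

/-- Elementary: for `0 ≤ s₀ ≤ s₁`, `−s₁² + 2 b s₁ ≤ −s₀² + 2 b s₀ + b²` (the parabola `s ↦ 2bs − s²` peaks at `b` with value `b²`
and decreases afterwards). -/
theorem neg_sq_add_le_of_le {s₀ s₁ b : ℝ} (h0 : 0 ≤ s₀) (h1 : s₀ ≤ s₁) :
    -s₁ ^ 2 + 2 * b * s₁ ≤ -s₀ ^ 2 + 2 * b * s₀ + b ^ 2 := by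
  by_cases hcase : b ≤ s₀
  · nlinarith [mul_nonneg (sub_nonneg.2 h1) (by linarith : 0 ≤ s₁ + s₀ - 2 * b)]
  · rw [not_le] at hcase
    nlinarith [sq_nonneg (s₁ - b), mul_nonneg h0 (by linarith : 0 ≤ 2 * b - s₀)]

/-- The real-variable core of `trim_compare`: with `a = 𝔇₀(w¹)`, `a₁ = 𝔇₁(w¹)`, `b = ‖w²‖`, `W = ‖w¹‖²`, `P = ‖T₁ w‖²`, `Q = ‖T₀ w‖²`,
`d = W + b² − Q` (the full drop), the expansions, the ledger `a₁ ≥ (1−ε)a` and the parabola trick give `P ≤ Q + 2εd + 6b√d + 15b²`. -/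
theorem trim_core {W a a₁ b P Q ε : ℝ} (ha : 0 ≤ a) (ha₁ : 0 ≤ a₁) (hb : 0 ≤ b) (hε0 : 0 ≤ ε) (hε1 : ε ≤ 1)
    (hlg : (1 - ε) * a ≤ a₁) (hP : P ≤ W - a₁ + 2 * b * Real.sqrt a₁ + b ^ 2)
    (hQlow : W - a - 2 * b * Real.sqrt a ≤ Q) (hQup : Q ≤ W - a + 2 * b * Real.sqrt a + b ^ 2) (hdQ : 0 ≤ W + b ^ 2 - Q) :
    P ≤ Q + 2 * ε * (W + b ^ 2 - Q) + 6 * b * Real.sqrt (W + b ^ 2 - Q) + 15 * b ^ 2 := by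
  have hsa : 0 ≤ Real.sqrt a := Real.sqrt_nonneg _
  have hsqa : Real.sqrt a ^ 2 = a := Real.sq_sqrt ha
  have hsqa₁ : Real.sqrt a₁ ^ 2 = a₁ := Real.sq_sqrt ha₁
  -- parabola trick
  have hla : 0 ≤ (1 - ε) * a := by nlinarith
  have hs0 : 0 ≤ Real.sqrt ((1 - ε) * a) := Real.sqrt_nonneg _
  have hs0sq : Real.sqrt ((1 - ε) * a) ^ 2 = (1 - ε) * a := Real.sq_sqrt hla
  have hge : Real.sqrt ((1 - ε) * a) ≤ Real.sqrt a₁ := Real.sqrt_le_sqrt hlg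
  have hle : Real.sqrt ((1 - ε) * a) ≤ Real.sqrt a := Real.sqrt_le_sqrt (by nlinarith)
  have key := neg_sq_add_le_of_le (b := b) hs0 hge
  rw [hsqa₁, hs0sq] at key
  have hmono : -a₁ + 2 * b * Real.sqrt a₁ ≤ -((1 - ε) * a) + 2 * b * Real.sqrt a + b ^ 2 := by
    have : 2 * b * Real.sqrt ((1 - ε) * a) ≤ 2 * b * Real.sqrt a := mul_le_mul_of_nonneg_left hle (by linarith)
    linarith
  -- `P − Q ≤ ε a + 4 b √a + 2 b²`
  have hmain : P - Q ≤ ε * a + 4 * b * Real.sqrt a + 2 * b ^ 2 := by linarith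
  -- `a ≤ 2 d + 4 b²`
  set d : ℝ := W + b ^ 2 - Q with hd
  have had : a ≤ 2 * d + 4 * b ^ 2 := by
    have h1 : a - 2 * b * Real.sqrt a ≤ d := by rw [hd]; linarith
    have h2 : 4 * b * Real.sqrt a ≤ a + 4 * b ^ 2 := by
      have h3 := sq_nonneg (Real.sqrt a - 2 * b)
      nlinarith [hsqa]
    linarith
  have hsd : 0 ≤ Real.sqrt d := Real.sqrt_nonneg _
  have hsqd : Real.sqrt d ^ 2 = d := Real.sq_sqrt hdQ
  have hsqrt_a : Real.sqrt a ≤ 3 / 2 * Real.sqrt d + 2 * b := by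
    have h1 : Real.sqrt a ≤ Real.sqrt (2 * d + 4 * b ^ 2) := Real.sqrt_le_sqrt had
    have h2' : 2 * d + 4 * b ^ 2 ≤ (3 / 2 * Real.sqrt d + 2 * b) ^ 2 := by
      have hx : (3 / 2 * Real.sqrt d + 2 * b) ^ 2 = 9 / 4 * Real.sqrt d ^ 2 + 6 * b * Real.sqrt d + 4 * b ^ 2 := by ring
      rw [hx, hsqd]
      have := mul_nonneg hb hsd
      linarith
    have h2 : Real.sqrt (2 * d + 4 * b ^ 2) ≤ 3 / 2 * Real.sqrt d + 2 * b := by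
      calc Real.sqrt (2 * d + 4 * b ^ 2) ≤ Real.sqrt ((3 / 2 * Real.sqrt d + 2 * b) ^ 2) := Real.sqrt_le_sqrt h2'
        _ = 3 / 2 * Real.sqrt d + 2 * b := Real.sqrt_sq (by positivity)
    exact h1.trans h2
  have h4b : 4 * b * Real.sqrt a ≤ 6 * b * Real.sqrt d + 8 * b ^ 2 := by
    have := mul_le_mul_of_nonneg_left hsqrt_a (by linarith : 0 ≤ 4 * b)
    linarith
  have hεa : ε * a ≤ 2 * ε * d + 4 * b ^ 2 := by
    have h1 := mul_le_mul_of_nonneg_left had hε0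
    have h2 : ε * (4 * b ^ 2) ≤ 1 * (4 * b ^ 2) := mul_le_mul_of_nonneg_right hε1 (by positivity)
    linarith
  have hb2 : 0 ≤ b ^ 2 := sq_nonneg b
  linarith

/-- **Datum trimming.**  Let `T₀`, `T₁` be linear contractions (the two propagators over `[0, t]`), `w = w¹ + w²` an orthogonal split of the datum,
and suppose the trimmed datum satisfies the ledger's conclusion `‖T₁ w¹‖² ≤ ‖T₀ w¹‖² + ε (‖w¹‖² − ‖T₀ w¹‖²)` with `0 ≤ ε ≤ 1`.  Then
`‖T₁ w‖² ≤ ‖T₀ w‖² + 2ε (‖w‖² − ‖T₀ w‖²) + 6 ‖w²‖ √(‖w‖² − ‖T₀ w‖²) + 15 ‖w²‖²`. -/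
theorem trim_compare (T₀ T₁ : V →L[ℝ] V) (hT₀ : ∀ x, ‖T₀ x‖ ≤ ‖x‖) (hT₁ : ∀ x, ‖T₁ x‖ ≤ ‖x‖) (w₁ w₂ : V)
    (horth : ⟪w₁, w₂⟫_ℝ = 0) {ε : ℝ} (hε0 : 0 ≤ ε) (hε1 : ε ≤ 1)
    (hledger : ‖T₁ w₁‖ ^ 2 ≤ ‖T₀ w₁‖ ^ 2 + ε * (‖w₁‖ ^ 2 - ‖T₀ w₁‖ ^ 2)) :
    ‖T₁ (w₁ + w₂)‖ ^ 2 ≤ ‖T₀ (w₁ + w₂)‖ ^ 2 + 2 * ε * (‖w₁ + w₂‖ ^ 2 - ‖T₀ (w₁ + w₂)‖ ^ 2)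
      + 6 * ‖w₂‖ * Real.sqrt (‖w₁ + w₂‖ ^ 2 - ‖T₀ (w₁ + w₂)‖ ^ 2) + 15 * ‖w₂‖ ^ 2 := by
  have ha : 0 ≤ ‖w₁‖ ^ 2 - ‖T₀ w₁‖ ^ 2 := sub_nonneg.2 (pow_le_pow_left₀ (norm_nonneg _) (hT₀ w₁) 2)
  have ha₁ : 0 ≤ ‖w₁‖ ^ 2 - ‖T₁ w₁‖ ^ 2 := sub_nonneg.2 (pow_le_pow_left₀ (norm_nonneg _) (hT₁ w₁) 2)
  have hb : 0 ≤ ‖w₂‖ := norm_nonneg _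
  have hw : ‖w₁ + w₂‖ ^ 2 = ‖w₁‖ ^ 2 + ‖w₂‖ ^ 2 := by rw [norm_add_sq_real, horth]; ring
  have hc₁ := abs_inner_apply_le_of_orthogonal T₁ hT₁ horth
  have hc₀ := abs_inner_apply_le_of_orthogonal T₀ hT₀ horth
  have hT₁w₂ : ‖T₁ w₂‖ ^ 2 ≤ ‖w₂‖ ^ 2 := pow_le_pow_left₀ (norm_nonneg _) (hT₁ w₂) 2
  have hT₀w₂ : ‖T₀ w₂‖ ^ 2 ≤ ‖w₂‖ ^ 2 := pow_le_pow_left₀ (norm_nonneg _) (hT₀ w₂) 2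
  have hexp₁ : ‖T₁ (w₁ + w₂)‖ ^ 2 = ‖T₁ w₁‖ ^ 2 + 2 * ⟪T₁ w₁, T₁ w₂⟫_ℝ + ‖T₁ w₂‖ ^ 2 := by rw [map_add, norm_add_sq_real]
  have hexp₀ : ‖T₀ (w₁ + w₂)‖ ^ 2 = ‖T₀ w₁‖ ^ 2 + 2 * ⟪T₀ w₁, T₀ w₂⟫_ℝ + ‖T₀ w₂‖ ^ 2 := by rw [map_add, norm_add_sq_real]
  have hP : ‖T₁ (w₁ + w₂)‖ ^ 2 ≤ ‖w₁‖ ^ 2 - (‖w₁‖ ^ 2 - ‖T₁ w₁‖ ^ 2)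
      + 2 * ‖w₂‖ * Real.sqrt (‖w₁‖ ^ 2 - ‖T₁ w₁‖ ^ 2) + ‖w₂‖ ^ 2 := by
    have h1 : ⟪T₁ w₁, T₁ w₂⟫_ℝ ≤ Real.sqrt (‖w₁‖ ^ 2 - ‖T₁ w₁‖ ^ 2) * ‖w₂‖ := (le_abs_self _).trans hc₁
    linarith
  have hQlow : ‖w₁‖ ^ 2 - (‖w₁‖ ^ 2 - ‖T₀ w₁‖ ^ 2) - 2 * ‖w₂‖ * Real.sqrt (‖w₁‖ ^ 2 - ‖T₀ w₁‖ ^ 2)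
      ≤ ‖T₀ (w₁ + w₂)‖ ^ 2 := by
    have h1 : -(Real.sqrt (‖w₁‖ ^ 2 - ‖T₀ w₁‖ ^ 2) * ‖w₂‖) ≤ ⟪T₀ w₁, T₀ w₂⟫_ℝ := (neg_abs_le _).trans' (neg_le_neg hc₀)
    nlinarith [sq_nonneg ‖T₀ w₂‖]
  have hQup : ‖T₀ (w₁ + w₂)‖ ^ 2 ≤ ‖w₁‖ ^ 2 - (‖w₁‖ ^ 2 - ‖T₀ w₁‖ ^ 2)
      + 2 * ‖w₂‖ * Real.sqrt (‖w₁‖ ^ 2 - ‖T₀ w₁‖ ^ 2) + ‖w₂‖ ^ 2 := by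
    have h1 : ⟪T₀ w₁, T₀ w₂⟫_ℝ ≤ Real.sqrt (‖w₁‖ ^ 2 - ‖T₀ w₁‖ ^ 2) * ‖w₂‖ := (le_abs_self _).trans hc₀
    linarith
  have hlg : (1 - ε) * (‖w₁‖ ^ 2 - ‖T₀ w₁‖ ^ 2) ≤ ‖w₁‖ ^ 2 - ‖T₁ w₁‖ ^ 2 := by nlinarith
  have hdQ : 0 ≤ ‖w₁‖ ^ 2 + ‖w₂‖ ^ 2 - ‖T₀ (w₁ + w₂)‖ ^ 2 := by
    rw [← hw]; exact sub_nonneg.2 (pow_le_pow_left₀ (norm_nonneg _) (hT₀ (w₁ + w₂)) 2)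
  have := trim_core ha ha₁ hb hε0 hε1 hlg hP hQlow hQup hdQ
  rw [hw]
  exact this

end

end Summit.AnomalousDissipation.AnomalousDissipation.Theorems.SolenoidalFractalHomogenisation.LagrangianStep
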